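import Literature.NumberTheory.QuadraticForms.HasseNormTheoremHolds
import Literature.NumberTheory.QuadraticForms.HasseMinkowskiTernaryLemmas
import Literature.NumberTheory.AdelicBaseChange.AutomorphicCompat
import Literature.NumberTheory.Automorphic.AdelicGroupData
import Mathlib.RingTheory.Artinian.Module
import HarnessLib

/-!
# Hasse's norm principle for the binary form `a² − e b²` over a finite étale algebra: adelic solvability of
# `a² − e b² = x` over `A ⊗_F 𝔸_F` implies solvability in `A` (O'Meara 65:23 / Vignéras III Cor. 3.4, factor by factor)

Topic `NumberTheory/NumberFields`; namespace `Literature.NumberTheory.NumberFields`.  THEOREMS ONLY (no definition, no named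
fact, no instance, no `sorry`).  Net debt 0: the only arithmetic input is the tree's PROVED Hasse norm theorem for quadratic
extensions of an arbitrary number field, `Literature.NumberTheory.Automorphic.hilbertSymbol_eq_one_of_forall_completions_holds`
(O'Meara 65:23, `QuadraticForms/HasseNormTheoremHolds`), together with the adelic base change `M ⊗_F 𝔸_F ≃ₐ[M] 𝔸_M` of the
vendored FLT packet (`NumberField.AdeleRing.baseChangeAlgEquiv`, Cassels–Fröhlich II §14 (14.2)) and Mathlib's structure theorem
for reduced artinian rings (`IsArtinianRing.equivPi : A ≃ ∏_𝔪 A ⧸ 𝔪`).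

## The statements

Let `F` be a number field, `e ∈ F`, `e ≠ 0`.

* §1 `exists_sq_sub_mul_sq_eq_of_adele` — ONE number field `M ⊇ F`: if `x ∈ Mˣ` and `a² − e b² = x` has a solution in the adèle
  ring `𝔸_M` (i.e. in every completion `M_w`, finite and infinite), then it has a solution in `M`.  For `e ∉ M²` this is LITERALLY
  Hasse's norm theorem for `M(√e)/M` in Hilbert-symbol form («`(e, x)_w = 1` for all `w` ⇒ `(e, x)_M = 1`», O'Meara 63:10 ↔ 65:23);
  for `e = d² ∈ M²` the form splits, `x = (a − db)(a + db)`, and `a = (x + 1)/2`, `b = (x − 1)/(2d)` solves it outright.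
* §2 `exists_sq_sub_smul_sq_eq_of_tensor_adele` — a FINITE REDUCED commutative `F`-algebra `A` (a finite étale `F`-algebra,
  `A ≃ ∏_𝔪 A⧸𝔪`, each `A⧸𝔪` a number field): if `x ∈ Aˣ` and `a² − e b² = x ⊗ 1` has a solution in `A ⊗_F 𝔸_F`, then `a² − e b² = x`
  has a solution in `A`.  Proof: push the adelic solution along `A ⊗_F 𝔸_F → (A⧸𝔪) ⊗_F 𝔸_F ≃ 𝔸_{A⧸𝔪}` for each maximal `𝔪`, apply §1,
  and reassemble through `IsArtinianRing.equivPi`.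

USE (cell hodgecm-mathlib, floor-0 line `F0_T1InnerFormTraceIdentity`, O11-0 step S4(b) «rational classes in a regular stable class
inject into adelic classes», `k(γ₀) = 1` of Rogawski 1990 §5.4 p. 72): for a regular semisimple `γ` in a unitary group `U(H)(L⁺)`,
`L/L⁺` CM with `L = L⁺(ε)`, `ε² = e`, the conjugacy classes inside the stable class of `γ` are classified by the norm classes
`(K⁺)ˣ / N(Kˣ)` of the quadratic étale extension `K = K⁺ ⊗_{L⁺} L` of the commutative `L⁺`-algebra `K⁺ = L[γ]^τ`, with
`N(a + εb) = a² − e b²`; this file is the local-to-global step for that norm (the vanishing of `Ш¹` of the torus `Res_{K⁺/L⁺} U(1)`).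

## References
* O. T. O'Meara, *Introduction to Quadratic Forms*, Grundlehren 117 (1963), §63B (63:10), §65D Thm. 65:23. [Omeara1963]
* M.-F. Vignéras, *Arithmétique des algèbres de quaternions*, LNM 800 (1980), Ch. III §3 Cor. 3.4. [VignerasLNM800]
* J. W. S. Cassels, A. Fröhlich (eds.), *Algebraic Number Theory* (1967), Ch. II §14 (14.2) `V_k ⊗_k K = V_K`. [CasselsFrohlichANT1967]
* J. D. Rogawski, *Automorphic Representations of Unitary Groups in Three Variables*, Ann. of Math. Stud. 123 (1990), §3.5–§3.6
  (tori of unitary groups), §5.4 p. 72 (`k(γ₀)`). [Rogawski1990]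
-/

set_option autoImplicit false

noncomputable section

open scoped TensorProduct NumberField.InfiniteAdeleRing NumberField.AdeleRing IsDedekindDomain
open NumberField IsDedekindDomain

namespace Literature.NumberTheory.NumberFields

open Literature.NumberTheory.QuadraticForms

/-! ## §1 One number field: adelic solvability of `a² − e b² = x` ⇒ solvability in `M` -/

section OneField

variable (M : Type) [Field M] [NumberField M]

/-- Over a field of characteristic `≠ 2` in which `e = d²` is a non-zero square, `a² − e b² = x` is solvable for EVERY `x`:
`a = (x + 1)/2`, `b = (x − 1)/(2d)` give `(a − db)(a + db) = 1 · x`. [cite: Omeara1963, §63B (63:10)] -/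
theorem exists_sq_sub_mul_sq_eq_of_isSquare {K : Type*} [Field K] [NeZero (2 : K)] {e : K} (he : e ≠ 0) (hsq : IsSquare e)
    (x : K) : ∃ a b : K, a ^ 2 - e * b ^ 2 = x := by
  obtain ⟨d, rfl⟩ := hsq
  have hd : d ≠ 0 := fun h => he (by rw [h, mul_zero])
  have h2 : (2 : K) ≠ 0 := two_ne_zero
  refine ⟨(x + 1) / 2, (x - 1) / (2 * d), ?_⟩
  field_simp
  ring

/-- The `w`-component of the principal adèle of `y ∈ M` is the image of `y` in `M_w`. [folklore] -/
private theorem adeleEval_algebraMap (w : HeightOneSpectrum (𝓞 M)) (y : M) :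
    Literature.NumberTheory.Automorphic.AdelicGroupData.adeleEval M w (algebraMap M (AdeleRing (𝓞 M) M) y) =
      algebraMap M (w.adicCompletion M) y := by
  rw [Literature.NumberTheory.Automorphic.AdelicGroupData.adeleEval_apply]
  change algebraMap M (FiniteAdeleRing (𝓞 M) M) y w = _
  rw [FiniteAdeleRing.algebraMap_apply, HeightOneSpectrum.algebraMap_adicCompletion]
  rfl

/-- **Hasse's norm theorem for `M(√e)/M`, adelic dress.**  `M` a number field, `e, x ∈ M`, `e ≠ 0`, `x ≠ 0`: if `a² − e b² = x` has a
solution in the adèle ring `𝔸_M`, then it has a solution in `M`.  (At every finite place `w` and every infinite place `w` the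
`w`-component of the adelic solution solves the equation in `M_w`, i.e. the Hilbert symbol `(e, x)_w` is `1`; for `e ∉ M²` the tree's
Hasse norm theorem `hilbertSymbol_eq_one_of_forall_completions_holds` gives `(e, x)_M = 1`; for `e ∈ M²` the form splits.)
[cite: Omeara1963, §65D Thm. 65:23] [cite: VignerasLNM800, Ch. III §3 Cor. 3.4] -/
theorem exists_sq_sub_mul_sq_eq_of_adele {e x : M} (he : e ≠ 0) (hx : x ≠ 0)
    (h : ∃ a b : AdeleRing (𝓞 M) M,
      a ^ 2 - algebraMap M (AdeleRing (𝓞 M) M) e * b ^ 2 = algebraMap M (AdeleRing (𝓞 M) M) x) :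
    ∃ a b : M, a ^ 2 - e * b ^ 2 = x := by
  by_cases hsq : IsSquare e
  · exact exists_sq_sub_mul_sq_eq_of_isSquare he hsq x
  obtain ⟨a, b, hab⟩ := h
  have hH := Literature.NumberTheory.Automorphic.hilbertSymbol_eq_one_of_forall_completions_holds M e x hsq hx ?_ ?_
  · exact (hilbertSymbol_eq_one_iff_exists_norm he hx).1 hH
  · -- finite places: read the `w`-component of the adelic solution
    intro w
    haveI : CharZero (w.adicCompletion M) := charZero_of_injective_algebraMap (algebraMap M _).injective
    rw [hilbertSymbol_eq_one_iff_exists_norm ((map_ne_zero _).2 he) ((map_ne_zero _).2 hx)]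
    refine ⟨Literature.NumberTheory.Automorphic.AdelicGroupData.adeleEval M w a,
      Literature.NumberTheory.Automorphic.AdelicGroupData.adeleEval M w b, ?_⟩
    have := congrArg (Literature.NumberTheory.Automorphic.AdelicGroupData.adeleEval M w) hab
    simpa only [map_sub, map_pow, map_mul, adeleEval_algebraMap] using this
  · -- infinite places
    intro w
    haveI : CharZero w.Completion := charZero_of_injective_algebraMap (algebraMap M _).injective
    rw [hilbertSymbol_eq_one_iff_exists_norm ((map_ne_zero _).2 he) ((map_ne_zero _).2 hx)]
    let π : AdeleRing (𝓞 M) M →+* w.Completion := (Pi.evalRingHom _ w).comp (RingHom.fst _ _)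
    have hπ : ∀ y : M, π (algebraMap M (AdeleRing (𝓞 M) M) y) = algebraMap M w.Completion y := fun _ => rfl
    refine ⟨π a, π b, ?_⟩
    have := congrArg π hab
    simpa only [map_sub, map_pow, map_mul, hπ] using this

end OneField

/-! ## §2 A finite étale `F`-algebra: adelic solvability over `A ⊗_F 𝔸_F` ⇒ solvability in `A` -/

section Etale

variable {F : Type} [Field F] [NumberField F] {A : Type} [CommRing A] [Algebra F A]

/-- Pushing an adelic solution over `A ⊗_F 𝔸_F` to the adèle ring of a number field `M` along an `F`-algebra map `π : A → M`
(through `A ⊗_F 𝔸_F → M ⊗_F 𝔸_F ≃ 𝔸_M`, Cassels–Fröhlich II (14.2)). [cite: CasselsFrohlichANT1967, Ch. II §14 (14.2)] -/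
theorem exists_adele_sq_sub_mul_sq_eq_of_tensor (M : Type) [Field M] [NumberField M] [Algebra F M] (π : A →ₐ[F] M)
    {e : F} {x : A} (h : ∃ a b : A ⊗[F] AdeleRing (𝓞 F) F, a ^ 2 - e • b ^ 2 = x ⊗ₜ[F] 1) :
    ∃ a b : AdeleRing (𝓞 M) M,
      a ^ 2 - algebraMap M (AdeleRing (𝓞 M) M) (algebraMap F M e) * b ^ 2 = algebraMap M (AdeleRing (𝓞 M) M) (π x) := by
  obtain ⟨a, b, hab⟩ := h
  let Ψ : A ⊗[F] AdeleRing (𝓞 F) F →+* AdeleRing (𝓞 M) M :=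
    (NumberField.AdeleRing.baseChangeAlgEquiv F M).toRingEquiv.toRingHom.comp
      (Algebra.TensorProduct.map π (AlgHom.id F (AdeleRing (𝓞 F) F))).toRingHom
  have hΨ : ∀ (y : A), Ψ (y ⊗ₜ[F] 1) = algebraMap M (AdeleRing (𝓞 M) M) (π y) := by
    intro y
    change NumberField.AdeleRing.baseChangeAlgEquiv F M
      (Algebra.TensorProduct.map π (AlgHom.id F (AdeleRing (𝓞 F) F)) (y ⊗ₜ[F] 1)) = _
    rw [Algebra.TensorProduct.map_tmul, AlgHom.id_apply,
      Literature.NumberTheory.AdelicBaseChange.adeleRing_baseChangeAlgEquiv_tmul, map_one, mul_one]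
  have hΨe : Ψ (algebraMap F (A ⊗[F] AdeleRing (𝓞 F) F) e) = algebraMap M (AdeleRing (𝓞 M) M) (algebraMap F M e) := by
    rw [Algebra.TensorProduct.algebraMap_apply, hΨ, AlgHom.commutes]
  refine ⟨Ψ a, Ψ b, ?_⟩
  have := congrArg Ψ hab
  rw [Algebra.smul_def, map_sub, map_pow, map_mul, map_pow, hΨe, hΨ] at this
  exact this

/-- **Hasse's norm principle for `a² − e b²` over a finite étale `F`-algebra.**  `F` a number field, `A` a finite reduced
commutative `F`-algebra, `e ∈ F`, `e ≠ 0`, `x ∈ Aˣ`: if `a² − e b² = x ⊗ 1` is solvable in `A ⊗_F 𝔸_F` then `a² − e b² = x` is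
solvable in `A`.  (`A ≃ ∏_𝔪 A⧸𝔪` by `IsArtinianRing.equivPi`; each `A⧸𝔪` is a number field; §1 in each factor.)
[cite: Omeara1963, §65D Thm. 65:23] [cite: VignerasLNM800, Ch. III §3 Cor. 3.4] [cite: CasselsFrohlichANT1967, Ch. II §14 (14.2)] -/
theorem exists_sq_sub_smul_sq_eq_of_tensor_adele [FiniteDimensional F A] [IsReduced A] {e : F} (he : e ≠ 0) {x : A}
    (hx : IsUnit x) (h : ∃ a b : A ⊗[F] AdeleRing (𝓞 F) F, a ^ 2 - e • b ^ 2 = x ⊗ₜ[F] 1) :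
    ∃ a b : A, a ^ 2 - e • b ^ 2 = x := by
  haveI : IsArtinianRing A := IsArtinianRing.of_finite F A
  -- factor by factor
  have hloc : ∀ 𝔪 : MaximalSpectrum A, ∃ a b : A ⧸ 𝔪.asIdeal,
      a ^ 2 - algebraMap F (A ⧸ 𝔪.asIdeal) e * b ^ 2 = Ideal.Quotient.mk 𝔪.asIdeal x := by
    intro 𝔪
    haveI := 𝔪.isMaximal
    letI : Field (A ⧸ 𝔪.asIdeal) := Ideal.Quotient.field 𝔪.asIdeal
    haveI : CharZero (A ⧸ 𝔪.asIdeal) := charZero_of_injective_algebraMap (algebraMap F (A ⧸ 𝔪.asIdeal)).injective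
    haveI : FiniteDimensional ℚ (A ⧸ 𝔪.asIdeal) := Module.Finite.trans F (A ⧸ 𝔪.asIdeal)
    haveI : NumberField (A ⧸ 𝔪.asIdeal) := ⟨⟩
    have hπ := exists_adele_sq_sub_mul_sq_eq_of_tensor (F := F) (A ⧸ 𝔪.asIdeal) (Ideal.Quotient.mkₐ F 𝔪.asIdeal) (x := x) h
    have he' : algebraMap F (A ⧸ 𝔪.asIdeal) e ≠ 0 := (map_ne_zero _).2 he
    have hx' : Ideal.Quotient.mkₐ F 𝔪.asIdeal x ≠ 0 := (hx.map (Ideal.Quotient.mkₐ F 𝔪.asIdeal)).ne_zero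
    exact exists_sq_sub_mul_sq_eq_of_adele (A ⧸ 𝔪.asIdeal) he' hx' hπ
  choose a b hab using hloc
  refine ⟨(IsArtinianRing.equivPi A).symm a, (IsArtinianRing.equivPi A).symm b, ?_⟩
  apply (IsArtinianRing.equivPi A).injective
  funext 𝔪
  rw [Algebra.smul_def, map_sub, map_pow, map_mul, map_pow, AlgEquiv.apply_symm_apply, AlgEquiv.apply_symm_apply]
  rw [Pi.sub_apply, Pi.mul_apply, Pi.pow_apply, Pi.pow_apply, IsArtinianRing.equivPi_apply, IsArtinianRing.equivPi_apply]
  exact hab 𝔪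

end Etale

end Literature.NumberTheory.NumberFields

end
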